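import Summits.ValiantsHypothesis.ValiantsHypothesis.Theorems.NewtonFramesTwoProductsFrameRungTwoTrinomialWords

/-!
# Crux `TwoProducts` (stmt-5906), line `FrameRungTwo`: the cube of a cross-cancelling vertex word on CARRY frames

Tools for the carry-frame residual of the line's open stub `stub_crossCancelCount` at `k ≤ 2` (two dissociated frames, one
product each, ANY number of letters, parallelogram coincidences / carries ALLOWED — no hypothesis beyond dissociation).
Setting as in `…FrameRungTwoTrinomialRigidity.lean`: functional `l`, factor tuples `f, g` on dissociated frames with key-top
tuples `T, T'`, an exponent `e` above which everything is cancelled (`hzero`), the common top (`htop`, `hTe`), and a word `a`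
of `f` with `Σ a = e`.

* `promote_cancelled` — every PARTIAL PROMOTION `b` of `a` (`b j ∈ {a j, T j}`, `b ≠ a`; a proper "un-demotion corner" of the
  demotion cube of `a`) is key-above `e`, hence cancelled: `coeff (Σ b) (Π f) + coeff (Σ b) (Π g) = 0`;
* `promote_word` — hence `Σ b` is a word sum of the OTHER frame `g`, with the product of its letter coefficients equal to MINUS the
  product of the `f`-letter coefficients of `b` (the whole punctured cube above a cross-cancelling vertex lies in the other
  frame's sumset — the "cube lemma" of the carry calculus, CALIBRATION-FrameRungTwo-g2.md §7 / -g3.md §3);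
* `promote_ratio` — the multiplicative bookkeeping: for the `g`-word `b'` of a corner `b`, the product of the demotion RATIOS of `b`
  (over its demoted coordinates, w.r.t. `T`) equals that of `b'` (w.r.t. `T'`);
* `not_word_of_vertex` — the vertex itself is NOT such a corner of the other frame: no word `b'` of `g` has `Σ b' = e` with the
  cancelling coefficient (so every representation of `e` by `g`-letters obtained from the corners must collide in a coordinate).

These are exactly the hypotheses-free parts of g2's `step_three` / `vertex_form_three`; the no-parallelogram hypothesis of
`…FrameRungTwoNoParallelogram.lean` was only used to forbid the collisions.  Honest scope: structural lemmas for ONE stub of a rung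
strictly below the crux `TwoProducts`; they do not bound anything by themselves and nothing here bears on `VP ≠ VNP`.
[ours; setting KPTT arXiv:1308.2286 §2, §5]
-/

set_option linter.dupNamespace false

namespace Summit.ValiantsHypothesis.ValiantsHypothesis.Theorems.NewtonFramesTwoProducts.FrameRungTwoTrinomial

open MvPolynomial
open scoped BigOperators Classical
open Summit.ValiantsHypothesis.Theorems.DissociatedFixedK (lexKey lexKey_injective lexTop lexTop_mem lexKey_le_lexTop)
open Summit.ValiantsHypothesis.ValiantsHypothesis.Theorems.DissociatedFixedK.Negative (emb emb_injective)
open Summit.ValiantsHypothesis.ValiantsHypothesis.Theorems.NewtonFramesTwoProducts.FrameRungTwoBinomial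
  (emb_add emb_sum lexKey_sum apply_le_of_lexKey_le lexKey_lt_of_apply_lt lexKey_sum_lt_sum lexKey_sum_le_sum
   eq_T_of_not_mem_filter ne_T_of_mem_filter lexKey_sum_lt_T lexKey_sum_le_T coeff_word exists_word prod_coeff_ne_zero top_eq
   topCoeff_add_eq_zero)

noncomputable section

section Cube

variable {m : ℕ}

/-- A partial promotion of a word of `f` is a word of `f`. -/
theorem promote_mem (f : Fin m → MvPolynomial (Fin 2) ℂ) (T : Fin m → (Fin 2 →₀ ℕ)) (hT : ∀ j, T j ∈ (f j).support)
    {a b : Fin m → (Fin 2 →₀ ℕ)} (ha : ∀ j, a j ∈ (f j).support) (hb : ∀ j, b j = a j ∨ b j = T j) (j : Fin m) :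
    b j ∈ (f j).support := by
  rcases hb j with h | h
  · rw [h]; exact ha j
  · rw [h]; exact hT j

/-- A partial promotion different from the word promotes some demoted letter. -/
theorem promote_strict {T a b : Fin m → (Fin 2 →₀ ℕ)} (hb : ∀ j, b j = a j ∨ b j = T j) (hne : b ≠ a) :
    ∃ j, b j = T j ∧ a j ≠ T j := by
  obtain ⟨j, hj⟩ := Function.ne_iff.1 hne
  rcases hb j with h | h
  · exact absurd h hj
  · exact ⟨j, h, fun haj => hj (by rw [h, haj])⟩

/-- **Corners are cancelled.**  Every partial promotion `b ≠ a` of the vertex word `a` (`Σ a = e`) has its sum key-above `e`,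
and the two products cancel there. -/
theorem promote_cancelled (l : (Fin 2 → ℝ) →L[ℝ] ℝ) (f g : Fin m → MvPolynomial (Fin 2) ℂ) (T : Fin m → (Fin 2 →₀ ℕ))
    (hTmax : ∀ j, ∀ x ∈ (f j).support, lexKey l x ≤ lexKey l (T j))
    (e : Fin 2 →₀ ℕ)
    (hzero : ∀ x : Fin 2 →₀ ℕ, x ≠ e → l (emb e) ≤ l (emb x) → coeff x (∏ j, f j) + coeff x (∏ j, g j) = 0)
    {a b : Fin m → (Fin 2 →₀ ℕ)} (ha : ∀ j, a j ∈ (f j).support) (hea : ∑ j, a j = e)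
    (hb : ∀ j, b j = a j ∨ b j = T j) (hne : b ≠ a) :
    lexKey l e < lexKey l (∑ j, b j) ∧ coeff (∑ j, b j) (∏ j, f j) + coeff (∑ j, b j) (∏ j, g j) = 0 := by
  have hkey : lexKey l e < lexKey l (∑ j, b j) := by
    rw [← hea]
    exact lexKey_sum_lt_promote l f T hTmax ha hb (promote_strict hb hne)
  refine ⟨hkey, hzero _ (fun h => by rw [h] at hkey; exact lt_irrefl _ hkey) (apply_le_of_lexKey_le l hkey.le)⟩

/-- **The cube lemma (carry frames).**  Every partial promotion `b ≠ a` of the vertex word is a word sum of the OTHER frame: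
there is a word `b'` of `g` with `Σ b' = Σ b`, whose letter-coefficient product is minus that of `b`. -/
theorem promote_word (l : (Fin 2 → ℝ) →L[ℝ] ℝ) (f g : Fin m → MvPolynomial (Fin 2) ℂ) (T : Fin m → (Fin 2 →₀ ℕ))
    (hT : ∀ j, T j ∈ (f j).support) (hTmax : ∀ j, ∀ x ∈ (f j).support, lexKey l x ≤ lexKey l (T j))
    (hinjf : ∀ a b : Fin m → (Fin 2 →₀ ℕ), (∀ j, a j ∈ (f j).support) → (∀ j, b j ∈ (f j).support) →
      ∑ j, a j = ∑ j, b j → a = b)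
    (hinjg : ∀ a b : Fin m → (Fin 2 →₀ ℕ), (∀ j, a j ∈ (g j).support) → (∀ j, b j ∈ (g j).support) →
      ∑ j, a j = ∑ j, b j → a = b)
    (e : Fin 2 →₀ ℕ)
    (hzero : ∀ x : Fin 2 →₀ ℕ, x ≠ e → l (emb e) ≤ l (emb x) → coeff x (∏ j, f j) + coeff x (∏ j, g j) = 0)
    {a b : Fin m → (Fin 2 →₀ ℕ)} (ha : ∀ j, a j ∈ (f j).support) (hea : ∑ j, a j = e)
    (hb : ∀ j, b j = a j ∨ b j = T j) (hne : b ≠ a) :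
    ∃ b' : Fin m → (Fin 2 →₀ ℕ), (∀ i, b' i ∈ (g i).support) ∧ ∑ i, b' i = ∑ j, b j ∧
      ∏ i, coeff (b' i) (g i) = -∏ j, coeff (b j) (f j) := by
  obtain ⟨-, hcan⟩ := promote_cancelled l f g T hTmax e hzero ha hea hb hne
  have hbmem : ∀ j, b j ∈ (f j).support := promote_mem f T hT ha hb
  have hcf : coeff (∑ j, b j) (∏ j, f j) = ∏ j, coeff (b j) (f j) := coeff_word f hinjf _ hbmem
  have hcf0 : coeff (∑ j, b j) (∏ j, f j) ≠ 0 := by rw [hcf]; exact prod_coeff_ne_zero f _ hbmem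
  have hgmem : (∑ j, b j) ∈ (∏ j, g j).support := by
    rw [mem_support_iff]; intro h; rw [h, add_zero] at hcan; exact hcf0 hcan
  obtain ⟨b', hb', hsum⟩ := exists_word g hinjg hgmem
  refine ⟨b', hb', hsum, ?_⟩
  have hcg : coeff (∑ j, b j) (∏ j, g j) = ∏ i, coeff (b' i) (g i) := by
    rw [← hsum, coeff_word g hinjg _ hb']
  rw [hcf, hcg] at hcan
  exact eq_neg_of_add_eq_zero_right hcan

/-- **Ratio bookkeeping for corners.**  For the `g`-word `b'` of a corner `b` (as in `promote_word`), the product of the demotion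
ratios of `b` (over the coordinates where `b` is below `T`) equals the product of the demotion ratios of `b'` (w.r.t. `T'`). -/
theorem promote_ratio (l : (Fin 2 → ℝ) →L[ℝ] ℝ) (f g : Fin m → MvPolynomial (Fin 2) ℂ) (T T' : Fin m → (Fin 2 →₀ ℕ))
    (hT : ∀ j, T j ∈ (f j).support) (hT' : ∀ j, T' j ∈ (g j).support)
    (hinjf : ∀ a b : Fin m → (Fin 2 →₀ ℕ), (∀ j, a j ∈ (f j).support) → (∀ j, b j ∈ (f j).support) →
      ∑ j, a j = ∑ j, b j → a = b)
    (hinjg : ∀ a b : Fin m → (Fin 2 →₀ ℕ), (∀ j, a j ∈ (g j).support) → (∀ j, b j ∈ (g j).support) →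
      ∑ j, a j = ∑ j, b j → a = b)
    (e : Fin 2 →₀ ℕ)
    (hzero : ∀ x : Fin 2 →₀ ℕ, x ≠ e → l (emb e) ≤ l (emb x) → coeff x (∏ j, f j) + coeff x (∏ j, g j) = 0)
    (htop : ∑ j, T j = ∑ j, T' j) (hTe : lexKey l e < lexKey l (∑ j, T j))
    {b b' : Fin m → (Fin 2 →₀ ℕ)}
    (hprod : ∏ i, coeff (b' i) (g i) = -∏ j, coeff (b j) (f j)) :
    ∏ j ∈ Finset.univ.filter (fun i => b i ≠ T i), (coeff (b j) (f j) / coeff (T j) (f j)) =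
      ∏ i ∈ Finset.univ.filter (fun i => b' i ≠ T' i), (coeff (b' i) (g i) / coeff (T' i) (g i)) := by
  have hA0 : ∏ j, coeff (T j) (f j) ≠ 0 := prod_coeff_ne_zero f _ hT
  have htc := topCoeff_add_eq_zero l f g T T' hT hT' hinjf hinjg e hzero htop hTe
  have hB : ∏ j, coeff (T' j) (g j) = -∏ j, coeff (T j) (f j) := eq_neg_of_add_eq_zero_right htc
  have h1 := prod_coeff_ratio f T hT b
  have h2 := prod_coeff_ratio g T' hT' b'
  rw [h1, h2, hB, neg_mul, neg_inj] at hprod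
  exact (mul_left_cancel₀ hA0 hprod).symm

/-- **The vertex is not a corner of the other frame.**  If `e` is NOT cancelled (it is a support point of `Π f + Π g`), then no
word `b'` of `g` has `Σ b' = e` with letter-coefficient product equal to minus that of the vertex word `a`. -/
theorem not_word_of_vertex (f g : Fin m → MvPolynomial (Fin 2) ℂ)
    (hinjf : ∀ a b : Fin m → (Fin 2 →₀ ℕ), (∀ j, a j ∈ (f j).support) → (∀ j, b j ∈ (f j).support) →
      ∑ j, a j = ∑ j, b j → a = b)
    (hinjg : ∀ a b : Fin m → (Fin 2 →₀ ℕ), (∀ j, a j ∈ (g j).support) → (∀ j, b j ∈ (g j).support) →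
      ∑ j, a j = ∑ j, b j → a = b)
    (e : Fin 2 →₀ ℕ) (he : coeff e (∏ j, f j) + coeff e (∏ j, g j) ≠ 0)
    {a : Fin m → (Fin 2 →₀ ℕ)} (ha : ∀ j, a j ∈ (f j).support) (hea : ∑ j, a j = e)
    {b' : Fin m → (Fin 2 →₀ ℕ)} (hb' : ∀ i, b' i ∈ (g i).support) (hsum : ∑ i, b' i = e) :
    ∏ i, coeff (b' i) (g i) ≠ -∏ j, coeff (a j) (f j) := by
  intro h
  apply he
  rw [← hea, coeff_word f hinjf _ ha]
  rw [hea, ← hsum, coeff_word g hinjg _ hb', h]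
  ring

/-- **Single un-demotions are resolved** (the level-1 carry calculus, no hypothesis on the frames): every one-letter
un-demotion `e + (T j − a j)` of the vertex word (when `a` demotes at least two letters) is a word sum of `g`. -/
theorem undemote_word (l : (Fin 2 → ℝ) →L[ℝ] ℝ) (f g : Fin m → MvPolynomial (Fin 2) ℂ) (T : Fin m → (Fin 2 →₀ ℕ))
    (hT : ∀ j, T j ∈ (f j).support) (hTmax : ∀ j, ∀ x ∈ (f j).support, lexKey l x ≤ lexKey l (T j))
    (hinjf : ∀ a b : Fin m → (Fin 2 →₀ ℕ), (∀ j, a j ∈ (f j).support) → (∀ j, b j ∈ (f j).support) →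
      ∑ j, a j = ∑ j, b j → a = b)
    (hinjg : ∀ a b : Fin m → (Fin 2 →₀ ℕ), (∀ j, a j ∈ (g j).support) → (∀ j, b j ∈ (g j).support) →
      ∑ j, a j = ∑ j, b j → a = b)
    (e : Fin 2 →₀ ℕ)
    (hzero : ∀ x : Fin 2 →₀ ℕ, x ≠ e → l (emb e) ≤ l (emb x) → coeff x (∏ j, f j) + coeff x (∏ j, g j) = 0)
    {a : Fin m → (Fin 2 →₀ ℕ)} (ha : ∀ j, a j ∈ (f j).support) (hea : ∑ j, a j = e)
    {j₀ : Fin m} (hj₀ : a j₀ ≠ T j₀) :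
    ∃ b' : Fin m → (Fin 2 →₀ ℕ), (∀ i, b' i ∈ (g i).support) ∧
      emb (∑ i, b' i) = emb e + (emb (T j₀) - emb (a j₀)) ∧
      ∏ i, coeff (b' i) (g i) = -∏ j, coeff (Function.update a j₀ (T j₀) j) (f j) := by
  have hb : ∀ j, Function.update a j₀ (T j₀) j = a j ∨ Function.update a j₀ (T j₀) j = T j := by
    intro j
    rcases eq_or_ne j j₀ with rfl | hne
    · right; rw [Function.update_self]
    · left; rw [Function.update_of_ne hne]
  have hne : Function.update a j₀ (T j₀) ≠ a := by
    intro h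
    have := congrFun h j₀
    rw [Function.update_self] at this
    exact hj₀ this.symm
  obtain ⟨b', hb', hsum, hprod⟩ := promote_word l f g T hT hTmax hinjf hinjg e hzero ha hea hb hne
  refine ⟨b', hb', ?_, hprod⟩
  rw [hsum, emb_sum_update a j₀ (T j₀), ← hea]
  abel

end Cube

end

end Summit.ValiantsHypothesis.ValiantsHypothesis.Theorems.NewtonFramesTwoProducts.FrameRungTwoTrinomial
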